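import Mathlib
import Summits.NavierStokesRegularity.NavierStokesRegularity.Theorems.EulerZoomLiouvillePowerGaugeEulerLiouvilleClockRigidity
import Summits.NavierStokesRegularity.NavierStokesRegularity.Theorems.EulerZoomLiouvillePowerGaugeEulerLiouvilleSelfSimilarPastStrata
import Summits.NavierStokesRegularity.NavierStokesRegularity.Theorems.EulerZoomLiouvillePowerGaugeEulerLiouvilleSelfSimilarPiercingSpheres
import Summits.NavierStokesRegularity.NavierStokesRegularity.Theorems.EulerZoomLiouvillePowerGaugeEulerLiouvillePastFastClock
import Summits.NavierStokesRegularity.NavierStokesRegularity.Theorems.EulerZoomLiouvillePowerGaugeEulerLiouvilleFluxWindow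
import Literature.Analysis.FluidPDE.SelfSimilarProofs
import Literature.Analysis.FluidPDE.NSViscosityRescaling
import Literature.Analysis.FluidPDE.SelfSimilarEulerVorticityCompactSupport
import HarnessLib

/-!
# WINDOW POWER CLOCKS WITH A TAME `C²` PROFILE are trivial — any exponent `0 < g < ½`, any blow-up time `T₀ ≥ 0`
# (crux `EulerZoomLiouville.PowerGaugeEulerLiouville` = stmt-NavierStokesRegularity-19832; line `logtime-breathers` of ns-idea-11, a bite out of the
# residue T4 `stub_powerClockRest` — member-level fillers)

Route `EulerZoomLiouville` (NavierStokesRegularity); width seat ns-ezl-w4 g2.  By T1 (clock rigidity, `ClockRigidity.clockRigidity_of_classical_shapePreserving`)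
a classical SHAPE-PRESERVING member is a log-time breather, steady, or a POWER CLOCK `u(τ, y) = (T₀−τ)^{g−1} W((T₀−τ)^{−g} y)` (`τ < 0`) about
some `T₀ ≥ 0` with SOME exponent `g`.  The tree kills the fast clocks `g > ½ − ρ/5` and the slow clocks `g < γ = 1/(2+ρ)` about `T₀ = 0`
(`PastShape.*`, the `A`-gauge alone, profile arbitrary); the exponent WINDOW `g ∈ [γ, ½ − ρ/5]` (and every `g ≤ ½ − ρ/5` about `T₀ > 0`) is
the registered residue T4, which at `g = γ`, `T₀ = 0` is the lead's self-similar residue (THE ONE STATEMENT).  The lead's profile-level levers are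
`γ`-GENERAL — they only use the profile equation CIV (3.3) with drift rate `γ ∈ (0, ½)`:

* `Loc.curl_eq_zero_of_piercingIrrotational` (p613616): irrotational piercing on spheres beyond every radius ⇒ `curl ≡ 0`;
* `Loc.curl_eq_zero_of_sphereBarriers` (p611972), `Loc.curl_eq_zero_of_radialInflow` (ns-typeII-p1 g8), `Loc.sublinear_of_uniformContinuous_of_growth`,
  `IsSelfSimilarEulerProfile.curl_eq_zero_of_hasCompactSupport` (Literature).

So the whole TAME side of THE ONE STATEMENT transfers to every window exponent.  The dictionary (this file): for a classical member with the
power-clock representation, g0's `ClockRigidity.profile_identity` with the clocks `θ = (T₀−τ)^{g−1}`, `ℓ = (T₀−τ)^{g}` (coefficients `θ'ℓ/θ² = 1−g`,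
`−ℓ'/θ = g`) says that `(W, P)`, `P(z) = (T₀+1)^{2−2g} p(−1, (T₀+1)^{g} z)`, is a CIV (3.3) profile WITH EXPONENT `g`
(`PowerClock.isSelfSimilarEulerProfile`); the slice `τ = −1` of the `A`-gauge gives `∫_{B_L}‖W‖² ≤ C L^{1−2ρ}` (`PowerClock.profile_growth`); an
irrotational `W` is then zero (`Loc.eq_zero_of_curl_eq_zero_of_growth`, sub-volume growth), so `u ≡ 0` on the slab.

* `PowerClock.profile_eq` / `PowerClock.contDiff_profile` / `PowerClock.isDivFree_profile` / `PowerClock.isSelfSimilarEulerProfile` — the dictionary;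
* `PowerClock.profile_growth` — `∫⁻_{B_L}‖W‖ₑ² ≤ C·L^{1−2ρ}` for all `L > 0`;
* `PowerClock.ae_eq_zero_of_curl_eq_zero` — irrotational profile ⇒ trivial;
* `PowerClock.ae_eq_zero_of_piercingIrrotational` — MAIN: piercing at rate `g` ⇒ trivial; corollaries `…_of_sphereBarriers`, `…_of_radialInflow`,
  `…_of_uniformContinuous`, `…_of_compactCurl`.

All member-level theorems carry `0 < ρ ≤ ½` and the crux's three-gauge hypothesis verbatim (only the `A`-gauge is used; the suitable-weak and
weak-gradient data are not needed for a classical member and are omitted), `(u, p)` classical on `(−∞, 0)`, the representation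
`∀ τ < 0, ∀ y, u τ y = (T₀ − τ)^(g−1) • W ((T₀ − τ)^(−g) • y)` (T1's `IsPowerClock` disjunct verbatim), `0 ≤ T₀`, `0 < g < ½`.
RESIDUE of T4 after this file: power clocks with `0 < g < ½` and a NEEDLE profile (the `g`-twin of `¬ HasIrrotationalPiercing`: a vortical fast-inflow
channel `⟪y, W y⟫ ≤ −g‖y‖²`, `curl W y ≠ 0` through every large sphere), and the clocks `g ≤ 0` about `T₀ > 0`.

WHAT THIS IS NOT: not NS, not E — classical sub-strata of the crux CLASS 19832 on the MODEL lattice, `--supports` stmt-19832.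
[folklore; ConstantinIgnatovaVicol2026Putative §3.1 (3.2)–(3.3) (the ansatz with a general exponent)]
-/

noncomputable section

-- flat `Theorems/<Route><Decl>…` files of one crux share the namespace of the crux (tree convention: `Summit.<S>.<S>.…`)
set_option linter.dupNamespace false

open MeasureTheory Set Filter Topology Metric Function InnerProductSpace
open scoped RealInnerProductSpace NNReal ENNReal ContDiff

namespace Summit.NavierStokesRegularity.NavierStokesRegularity.Theorems.PowerGaugeEulerLiouville

open Literature.Analysis Literature.Analysis.FunctionSpaces Literature.Analysis.FluidPDE

namespace PowerClock

variable {ρ T₀ g : ℝ}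
  {u : ℝ → EuclideanSpace ℝ (Fin 3) → EuclideanSpace ℝ (Fin 3)} {p : ℝ → EuclideanSpace ℝ (Fin 3) → ℝ}
  {H : ℝ → EuclideanSpace ℝ (Fin 3) → EuclideanSpace ℝ (Fin 3) →L[ℝ] EuclideanSpace ℝ (Fin 3)} {c : ℝ≥0}
  {W : EuclideanSpace ℝ (Fin 3) → EuclideanSpace ℝ (Fin 3)}

/-! ### The dictionary: a classical power clock has a CIV (3.3) profile with exponent `g` -/

/-- The profile in terms of the slice `τ = −1`: `W z = ((T₀+1)^{g−1})⁻¹ • u(−1, (T₀+1)^{g} z)`. [folklore] -/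
theorem profile_eq (hT₀ : 0 ≤ T₀)
    (hW : ∀ τ : ℝ, τ < 0 → ∀ y, u τ y = (T₀ - τ) ^ (g - 1) • W ((T₀ - τ) ^ (-g) • y)) (z : EuclideanSpace ℝ (Fin 3)) :
    W z = ((T₀ + 1) ^ (g - 1))⁻¹ • u (-1) ((T₀ + 1) ^ g • z) := by
  have hs : (0 : ℝ) < T₀ + 1 := by linarith
  have h := hW (-1) (by norm_num) ((T₀ + 1) ^ g • z)
  rw [show T₀ - -1 = T₀ + 1 by ring, smul_smul, ← Real.rpow_add hs, neg_add_cancel, Real.rpow_zero, one_smul] at h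
  rw [h, smul_smul, inv_mul_cancel₀ (Real.rpow_pos_of_pos hs _).ne', one_smul]

/-- The profile of a classical power clock is smooth (in particular `C²`). [folklore] -/
theorem contDiff_profile (hcl : IsClassicalEulerSolutionOn (Iio 0) 0 u p) (hT₀ : 0 ≤ T₀)
    (hW : ∀ τ : ℝ, τ < 0 → ∀ y, u τ y = (T₀ - τ) ^ (g - 1) • W ((T₀ - τ) ^ (-g) • y)) : ContDiff ℝ 2 W := by
  have hrep : W = fun z => ((T₀ + 1) ^ (g - 1))⁻¹ • u (-1) ((T₀ + 1) ^ g • z) := funext (profile_eq hT₀ hW)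
  rw [hrep]
  have h1 : ContDiff ℝ 2 (u (-1)) := (hcl.contDiff_velocity (by norm_num : (-1 : ℝ) ∈ Iio 0)).of_le (by norm_cast)
  have h2 : ContDiff ℝ 2 (fun z : EuclideanSpace ℝ (Fin 3) => u (-1) ((T₀ + 1) ^ g • z)) := by fun_prop
  exact h2.const_smul _

/-- The profile of a classical power clock is divergence free. [folklore] -/
theorem isDivFree_profile (hcl : IsClassicalEulerSolutionOn (Iio 0) 0 u p) (hT₀ : 0 ≤ T₀)
    (hW : ∀ τ : ℝ, τ < 0 → ∀ y, u τ y = (T₀ - τ) ^ (g - 1) • W ((T₀ - τ) ^ (-g) • y)) : VectorCalculus.IsDivFree W := by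
  have hrep : W = fun z => ((T₀ + 1) ^ (g - 1))⁻¹ • u (-1) ((T₀ + 1) ^ g • z) := funext (profile_eq hT₀ hW)
  rw [hrep]
  have h1 : Differentiable ℝ (u (-1)) :=
    (hcl.contDiff_velocity (by norm_num : (-1 : ℝ) ∈ Iio 0)).differentiable (by simp)
  have hud : Differentiable ℝ (fun z : EuclideanSpace ℝ (Fin 3) => u (-1) ((T₀ + 1) ^ g • z)) := by fun_prop
  have hdiv : VectorCalculus.IsDivFree (fun z : EuclideanSpace ℝ (Fin 3) => u (-1) ((T₀ + 1) ^ g • z)) :=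
    (hcl.divFree (-1) (by norm_num : (-1 : ℝ) ∈ Iio 0)).comp_smul _
  exact VectorCalculus.IsDivFree.const_smul hud hdiv _

/-- **THE PROFILE EQUATION WITH EXPONENT `g`.**  A classical Euler solution on `(−∞,0)` with `u(τ, y) = (T₀−τ)^{g−1} W((T₀−τ)^{−g} y)` (`T₀ ≥ 0`) has a
CIV (3.3) profile `(W, P)` with exponent `g` and centre `0`, `P(z) = ((T₀+1)^{g−1})^{−2} p(−1, (T₀+1)^{g} z)` (any real `g`): g0's `ClockRigidity.profile_identity` with the
clocks `θ = (T₀−τ)^{g−1}`, `ℓ = (T₀−τ)^{g}` at `τ = −1` (`θ'ℓ/θ² = 1 − g`, `−ℓ'/θ = g`). [cite: ConstantinIgnatovaVicol2026Putative, §3.1 (3.2)–(3.3)] -/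
theorem isSelfSimilarEulerProfile (hcl : IsClassicalEulerSolutionOn (Iio 0) 0 u p) (hT₀ : 0 ≤ T₀)
    (hW : ∀ τ : ℝ, τ < 0 → ∀ y, u τ y = (T₀ - τ) ^ (g - 1) • W ((T₀ - τ) ^ (-g) • y)) :
    IsSelfSimilarEulerProfile g 0 W
      (fun y => (((T₀ + 1) ^ (g - 1)) ^ 2)⁻¹ * p (-1) ((T₀ + 1) ^ g • y)) := by
  have hW2 : ContDiff ℝ 2 W := contDiff_profile hcl hT₀ hW
  have hWd : Differentiable ℝ W := hW2.differentiable (by norm_num)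
  -- the clocks
  set θ : ℝ → ℝ := fun τ => (T₀ - τ) ^ (g - 1) with hθ
  set ℓ : ℝ → ℝ := fun τ => (T₀ - τ) ^ g with hℓ
  have hspos : ∀ τ : ℝ, τ < 0 → 0 < T₀ - τ := fun τ hτ => by linarith
  have hpos : ∀ τ : ℝ, τ < 0 → 0 < θ τ ∧ 0 < ℓ τ := fun τ hτ =>
    ⟨Real.rpow_pos_of_pos (hspos τ hτ) _, Real.rpow_pos_of_pos (hspos τ hτ) _⟩
  have hθD : ∀ τ : ℝ, τ < 0 → HasDerivAt θ ((-1) * (g - 1) * (T₀ - τ) ^ (g - 1 - 1)) τ := fun τ hτ =>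
    ((hasDerivAt_id τ).const_sub T₀).rpow_const (p := g - 1) (Or.inl (hspos τ hτ).ne')
  have hℓD : ∀ τ : ℝ, τ < 0 → HasDerivAt ℓ ((-1) * g * (T₀ - τ) ^ (g - 1)) τ := fun τ hτ =>
    ((hasDerivAt_id τ).const_sub T₀).rpow_const (p := g) (Or.inl (hspos τ hτ).ne')
  have hθd : DifferentiableOn ℝ θ (Iio 0) := fun τ hτ => (hθD τ hτ).differentiableAt.differentiableWithinAt
  have hℓd : DifferentiableOn ℝ ℓ (Iio 0) := fun τ hτ => (hℓD τ hτ).differentiableAt.differentiableWithinAt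
  have hu : ∀ τ : ℝ, τ < 0 → ∀ y, u τ y = θ τ • W ((ℓ τ)⁻¹ • y) := by
    intro τ hτ y
    rw [hW τ hτ y, hθ, hℓ, Real.rpow_neg (hspos τ hτ).le]
  -- the identity at `τ = −1`
  have h1 : (-1 : ℝ) < 0 := by norm_num
  have hs : (0 : ℝ) < T₀ + 1 := by linarith
  have hs1 : T₀ - -1 = T₀ + 1 := by ring
  set A : ℝ := (T₀ + 1) ^ (g - 1) with hA
  have hA0 : A ≠ 0 := (Real.rpow_pos_of_pos hs _).ne'
  have hθ1 : θ (-1) = A := by simp only [hθ, hs1, hA]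
  have hℓ1 : ℓ (-1) = (T₀ + 1) ^ g := by simp only [hℓ, hs1]
  have hℓA : ℓ (-1) = (T₀ + 1) * A := by
    have h := Real.rpow_add hs 1 (g - 1)
    rw [show (1 : ℝ) + (g - 1) = g by ring, Real.rpow_one] at h
    rw [hℓ1, hA, h]
  have hdθ : deriv θ (-1) = (1 - g) * A / (T₀ + 1) := by
    rw [(hθD (-1) h1).deriv, hs1, Real.rpow_sub_one hs.ne' (g - 1), ← hA]
    ring
  have hdℓ : deriv ℓ (-1) = -(g * A) := by
    rw [(hℓD (-1) h1).deriv, hs1, ← hA]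
    ring
  have hid := ClockRigidity.profile_identity hcl hpos hθd hℓd hu hWd h1
  have hc1 : deriv θ (-1) * ℓ (-1) / θ (-1) ^ 2 = 1 - g := by
    rw [hdθ, hℓA, hθ1]; field_simp
  have hc2 : -(deriv ℓ (-1) / θ (-1)) = g := by
    rw [hdℓ, hθ1]; field_simp
  -- the pressure profile and its gradient
  have hpD : Differentiable ℝ (p (-1)) := (hcl.contDiff_pressure h1).differentiable (by simp)
  have hpd : ∀ z : EuclideanSpace ℝ (Fin 3), DifferentiableAt ℝ (fun y => p (-1) ((T₀ + 1) ^ g • y)) z := by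
    intro z
    have : Differentiable ℝ (fun y : EuclideanSpace ℝ (Fin 3) => p (-1) ((T₀ + 1) ^ g • y)) := by fun_prop
    exact this z
  refine
    { contDiff_velocity := hW2
      contDiff_pressure := ?_
      profile_eq := fun z => ?_
      divFree := isDivFree_profile hcl hT₀ hW }
  · have hp1 : ContDiff ℝ 1 (p (-1)) := (hcl.contDiff_pressure h1).of_le (by norm_cast)
    have hp2 : ContDiff ℝ 1 (fun y : EuclideanSpace ℝ (Fin 3) => p (-1) ((T₀ + 1) ^ g • y)) := by fun_prop
    exact contDiff_const.mul hp2
  · have hidz := hid z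
    rw [hc1, hc2, hθ1, hℓ1, ClockRigidity.gradient_const_mul' (hpd z)] at hidz
    -- `hidz : (1 − g)•W z + g•DW z z + DW z (W z) = (−(A²)⁻¹) • ∇(p(−1) ∘ ℓ·)(z)`
    rw [sub_zero, map_add, map_smul, ClockRigidity.gradient_const_mul' (hpd z)]
    have h' : (1 - g) • W z + (g • fderiv ℝ W z z + fderiv ℝ W z (W z)) =
        (-(A ^ 2)⁻¹) • gradient (fun y => p (-1) ((T₀ + 1) ^ g • y)) z := by
      rw [← hidz]; abel
    rw [h', neg_smul, neg_add_cancel]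

/-! ### The `A`-gauge on one slice: sub-volume growth of the profile -/

/-- **Profile growth from one slice.**  If `u(τ, y) = (T₀−τ)^{g−1} W((T₀−τ)^{−g} y)` for `τ < 0` (`T₀ ≥ 0`) and the `A`-gauge `a^{2ρ} A(a; 0) ≤ c` holds,
then `∫⁻_{B_L}‖W‖ₑ² ≤ C · L^{1−2ρ}` for ALL `L > 0` with `C < ∞` (the slice `τ = −1` on the balls `a = (T₀+1)^{g} L > 1`, `PastShape.lintegral_ball_shape`,
then `Shifted.growth_of_growth_le` down to small `L` by continuity).  `0 < ρ ≤ ½`, `W` continuous. [folklore] -/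
theorem profile_growth (hρ : 0 < ρ) (hρh : ρ ≤ 1 / 2) (hT₀ : 0 ≤ T₀)
    (hA : ∀ a : ℝ, 0 < a → ENNReal.ofReal (a ^ (2 * ρ)) *
      cknA a (0 : ℝ × EuclideanSpace ℝ (Fin 3)) u ≤ (c : ℝ≥0∞))
    (hW : ∀ τ : ℝ, τ < 0 → ∀ y, u τ y = (T₀ - τ) ^ (g - 1) • W ((T₀ - τ) ^ (-g) • y)) (hWc : Continuous W) :
    ∃ C : ℝ≥0∞, C ≠ ⊤ ∧ ∀ L : ℝ, 0 < L →
      ∫⁻ y in ball (0 : EuclideanSpace ℝ (Fin 3)) L, ‖W y‖ₑ ^ 2 ≤ C * ENNReal.ofReal (L ^ (1 - 2 * ρ)) := by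
  have _h := hρ
  have hs : (0 : ℝ) < T₀ + 1 := by linarith
  set A : ℝ := (T₀ + 1) ^ (g - 1) with hAdef
  set ℓ : ℝ := (T₀ + 1) ^ g with hℓdef
  have hA0 : 0 < A := Real.rpow_pos_of_pos hs _
  have hℓ0 : 0 < ℓ := Real.rpow_pos_of_pos hs _
  have hS := hasScaledLocalEnergyBound_of_gaugeA hA
  -- the slice `τ = −1` in shape form
  have hslice : ∀ y, u (-1) y = A • W (ℓ⁻¹ • y) := by
    intro y
    rw [hW (-1) (by norm_num) y, show T₀ - -1 = T₀ + 1 by ring, Real.rpow_neg hs.le]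
  -- large scales `L ≥ ℓ⁻¹ + 1`
  set K : ℝ := A ^ 2 * ℓ ^ 3 with hK
  have hK0 : 0 < K := by positivity
  set C₀ : ℝ≥0∞ := ENNReal.ofReal (K⁻¹ * (c * ℓ ^ (1 - 2 * ρ))) with hC₀
  have hlarge : ∀ L : ℝ, ℓ⁻¹ + 1 ≤ L →
      ∫⁻ y in ball (0 : EuclideanSpace ℝ (Fin 3)) L, ‖W y‖ₑ ^ 2 ≤ C₀ * ENNReal.ofReal (L ^ (1 - 2 * ρ)) := by
    intro L hL
    have hL0 : 0 < L := lt_of_lt_of_le (by positivity) hL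
    set a : ℝ := ℓ * L with ha
    have ha1 : 1 < a := by
      have : ℓ * (ℓ⁻¹ + 1) ≤ ℓ * L := mul_le_mul_of_nonneg_left hL hℓ0.le
      rw [mul_add, mul_inv_cancel₀ hℓ0.ne', mul_one] at this
      rw [ha]; linarith
    have ha0 : 0 < a := by linarith
    have hmem : (-1 : ℝ) ∈ Ioo (-(a ^ 2)) 0 := by
      constructor
      · nlinarith
      · norm_num
    have hb := hS a ha0 (-1) hmem
    have hfun : (fun y => ‖u (-1) y‖ₑ ^ 2) = fun y => ‖A • W (ℓ⁻¹ • y)‖ₑ ^ 2 := by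
      funext y; rw [hslice y]
    rw [hfun, PastShape.lintegral_ball_shape hℓ0 W a, show ℓ⁻¹ * a = L by rw [ha, inv_mul_cancel_left₀ hℓ0.ne']] at hb
    -- divide by `K = A² ℓ³`
    set J : ℝ≥0∞ := ∫⁻ y in ball (0 : EuclideanSpace ℝ (Fin 3)) L, ‖W y‖ₑ ^ 2 with hJ
    have hunit : ENNReal.ofReal K⁻¹ * ENNReal.ofReal K = 1 := by
      rw [← ENNReal.ofReal_mul (inv_nonneg.2 hK0.le), inv_mul_cancel₀ hK0.ne', ENNReal.ofReal_one]
    calc J = ENNReal.ofReal K⁻¹ * (ENNReal.ofReal K * J) := by rw [← mul_assoc, hunit, one_mul]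
      _ ≤ ENNReal.ofReal K⁻¹ * ENNReal.ofReal (c * a ^ (1 - 2 * ρ)) := mul_le_mul_right hb _
      _ = C₀ * ENNReal.ofReal (L ^ (1 - 2 * ρ)) := by
          rw [hC₀, ← ENNReal.ofReal_mul (inv_nonneg.2 hK0.le), ← ENNReal.ofReal_mul (by positivity)]
          congr 1
          rw [ha, Real.mul_rpow hℓ0.le hL0.le]
          ring
  -- all scales
  have hL₀ : (1 : ℝ) ≤ ℓ⁻¹ + 1 := by have := inv_pos.2 hℓ0; linarith
  exact Shifted.growth_of_growth_le hWc (θ := 1 - 2 * ρ) (by linarith) hL₀ ENNReal.ofReal_ne_top hlarge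

/-! ### Member level -/

/-- From `W = 0` to the member: `u ≡ 0` on the slab (pointwise), hence a.e. [folklore] -/
theorem ae_eq_zero_of_profile_eq_zero
    (hW : ∀ τ : ℝ, τ < 0 → ∀ y, u τ y = (T₀ - τ) ^ (g - 1) • W ((T₀ - τ) ^ (-g) • y)) (hW0 : W = 0) :
    uncurry u =ᵐ[volume.restrict (Iio (0 : ℝ) ×ˢ (univ : Set (EuclideanSpace ℝ (Fin 3))))] 0 := by
  refine (ae_restrict_mem (measurableSet_Iio.prod MeasurableSet.univ)).mono ?_
  rintro ⟨τ, y⟩ ⟨hτ, -⟩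
  simp only [uncurry_apply_pair, Pi.zero_apply]
  rw [hW τ hτ y, hW0, Pi.zero_apply, smul_zero]

/-- **A classical power clock (`0 < g`, `T₀ ≥ 0`) with IRROTATIONAL profile is trivial** (crux hypotheses verbatim, `0 < ρ ≤ ½`): `div W = 0`, `curl W = 0`,
`∫_{B_L}‖W‖² ≲ L^{1−2ρ}` ⇒ `W = 0` (`Loc.eq_zero_of_curl_eq_zero_of_growth`). [folklore] -/
theorem ae_eq_zero_of_curl_eq_zero (hρ : 0 < ρ) (hρh : ρ ≤ 1 / 2)
    (hgauge : ∀ a : ℝ, 0 < a →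
      ENNReal.ofReal (a ^ (2 * ρ)) * cknA a (0 : ℝ × EuclideanSpace ℝ (Fin 3)) u +
          ENNReal.ofReal (a ^ ρ) * cknE a (0 : ℝ × EuclideanSpace ℝ (Fin 3)) H +
        ENNReal.ofReal (a ^ (2 * ρ)) * cknD a (0 : ℝ × EuclideanSpace ℝ (Fin 3)) p ≤ (c : ℝ≥0∞))
    (hcl : IsClassicalEulerSolutionOn (Iio 0) 0 u p) (hT₀ : 0 ≤ T₀)
    (hW : ∀ τ : ℝ, τ < 0 → ∀ y, u τ y = (T₀ - τ) ^ (g - 1) • W ((T₀ - τ) ^ (-g) • y))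
    (hcurl : ∀ x, curl W x = 0) :
    uncurry u =ᵐ[volume.restrict (Iio (0 : ℝ) ×ˢ (univ : Set (EuclideanSpace ℝ (Fin 3))))] 0 := by
  have hA : ∀ a : ℝ, 0 < a → ENNReal.ofReal (a ^ (2 * ρ)) *
      cknA a (0 : ℝ × EuclideanSpace ℝ (Fin 3)) u ≤ (c : ℝ≥0∞) :=
    fun a ha => le_trans (le_trans le_self_add le_self_add) (hgauge a ha)
  have hW2 : ContDiff ℝ 2 W := contDiff_profile hcl hT₀ hW
  obtain ⟨C, hC, hgrowth⟩ := profile_growth hρ hρh hT₀ hA hW hW2.continuous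
  have hW0 : W = 0 :=
    Loc.eq_zero_of_curl_eq_zero_of_growth hW2 hcurl (isDivFree_profile hcl hT₀ hW) hC (θ := 1 - 2 * ρ) (by linarith) hgrowth
  exact ae_eq_zero_of_profile_eq_zero hW hW0

/-- **MAIN — A CLASSICAL WINDOW POWER CLOCK WHOSE PROFILE HAS IRROTATIONAL PIERCING AT RATE `g` IS TRIVIAL.**  Crux hypotheses verbatim (`0 < ρ ≤ ½`) +
`(u, p)` classical on `(−∞,0)` + `u(τ, y) = (T₀−τ)^{g−1} W((T₀−τ)^{−g} y)` for `τ < 0` with `0 ≤ T₀`, `0 < g < ½` + radii `R` beyond every bound with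
`⟪y, W y⟫ ≤ −g‖y‖² ⇒ curl W y = 0` on `‖y‖ = R` ⇒ `u = 0` a.e. on `(−∞,0) × ℝ³`.  (`PowerClock.isSelfSimilarEulerProfile` + the lead's
`Loc.curl_eq_zero_of_piercingIrrotational` + `ae_eq_zero_of_curl_eq_zero`.)  The `g`-twin of `Loc.selfSimilar_ae_eq_zero_of_piercingIrrotationalC2_profile`.
[folklore] -/
theorem ae_eq_zero_of_piercingIrrotational (hρ : 0 < ρ) (hρh : ρ ≤ 1 / 2)
    (hgauge : ∀ a : ℝ, 0 < a →
      ENNReal.ofReal (a ^ (2 * ρ)) * cknA a (0 : ℝ × EuclideanSpace ℝ (Fin 3)) u +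
          ENNReal.ofReal (a ^ ρ) * cknE a (0 : ℝ × EuclideanSpace ℝ (Fin 3)) H +
        ENNReal.ofReal (a ^ (2 * ρ)) * cknD a (0 : ℝ × EuclideanSpace ℝ (Fin 3)) p ≤ (c : ℝ≥0∞))
    (hcl : IsClassicalEulerSolutionOn (Iio 0) 0 u p) (hT₀ : 0 ≤ T₀) (hg : 0 < g) (hg2 : g < 1 / 2)
    (hW : ∀ τ : ℝ, τ < 0 → ∀ y, u τ y = (T₀ - τ) ^ (g - 1) • W ((T₀ - τ) ^ (-g) • y))
    (hS : ∀ R₀ : ℝ, ∃ R : ℝ, R₀ ≤ R ∧ ∀ y : EuclideanSpace ℝ (Fin 3), ‖y‖ = R →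
      ⟪y, W y⟫ ≤ -(g * ‖y‖ ^ 2) → curl W y = 0) :
    uncurry u =ᵐ[volume.restrict (Iio (0 : ℝ) ×ˢ (univ : Set (EuclideanSpace ℝ (Fin 3))))] 0 :=
  have hprof := isSelfSimilarEulerProfile hcl hT₀ hW
  ae_eq_zero_of_curl_eq_zero hρ hρh hgauge hcl hT₀ hW (Loc.curl_eq_zero_of_piercingIrrotational hprof hg hg2 hS)

/-- **Corollary — BARRIER SPHERES at rate `κ < g` beyond every radius** (`⟪y, W y⟫ ≥ −κ‖y‖²` on `‖y‖ = R`): trivial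
(`Loc.curl_eq_zero_of_sphereBarriers`). [folklore] -/
theorem ae_eq_zero_of_sphereBarriers (hρ : 0 < ρ) (hρh : ρ ≤ 1 / 2)
    (hgauge : ∀ a : ℝ, 0 < a →
      ENNReal.ofReal (a ^ (2 * ρ)) * cknA a (0 : ℝ × EuclideanSpace ℝ (Fin 3)) u +
          ENNReal.ofReal (a ^ ρ) * cknE a (0 : ℝ × EuclideanSpace ℝ (Fin 3)) H +
        ENNReal.ofReal (a ^ (2 * ρ)) * cknD a (0 : ℝ × EuclideanSpace ℝ (Fin 3)) p ≤ (c : ℝ≥0∞))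
    (hcl : IsClassicalEulerSolutionOn (Iio 0) 0 u p) (hT₀ : 0 ≤ T₀) (hg : 0 < g) (hg2 : g < 1 / 2)
    (hW : ∀ τ : ℝ, τ < 0 → ∀ y, u τ y = (T₀ - τ) ^ (g - 1) • W ((T₀ - τ) ^ (-g) • y))
    {κ : ℝ} (hκ : κ < g)
    (hS : ∀ R₀ : ℝ, ∃ R : ℝ, R₀ ≤ R ∧ ∀ y : EuclideanSpace ℝ (Fin 3), ‖y‖ = R → -(κ * ‖y‖ ^ 2) ≤ ⟪y, W y⟫) :
    uncurry u =ᵐ[volume.restrict (Iio (0 : ℝ) ×ˢ (univ : Set (EuclideanSpace ℝ (Fin 3))))] 0 :=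
  have hprof := isSelfSimilarEulerProfile hcl hT₀ hW
  ae_eq_zero_of_curl_eq_zero hρ hρh hgauge hcl hT₀ hW (Loc.curl_eq_zero_of_sphereBarriers hprof hκ hS hg hg2)

/-- **Corollary — NO FAST RADIAL INFLOW at infinity at rate `κ < g`** (`⟪y, W y⟫ ≥ −κ‖y‖²` for `‖y‖ ≥ R₁`; ⊇ sub-drift ⊇ bounded profiles): trivial
(`Loc.curl_eq_zero_of_radialInflow`, ns-typeII-p1 g8). [folklore] -/
theorem ae_eq_zero_of_radialInflow (hρ : 0 < ρ) (hρh : ρ ≤ 1 / 2)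
    (hgauge : ∀ a : ℝ, 0 < a →
      ENNReal.ofReal (a ^ (2 * ρ)) * cknA a (0 : ℝ × EuclideanSpace ℝ (Fin 3)) u +
          ENNReal.ofReal (a ^ ρ) * cknE a (0 : ℝ × EuclideanSpace ℝ (Fin 3)) H +
        ENNReal.ofReal (a ^ (2 * ρ)) * cknD a (0 : ℝ × EuclideanSpace ℝ (Fin 3)) p ≤ (c : ℝ≥0∞))
    (hcl : IsClassicalEulerSolutionOn (Iio 0) 0 u p) (hT₀ : 0 ≤ T₀) (hg : 0 < g) (hg2 : g < 1 / 2)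
    (hW : ∀ τ : ℝ, τ < 0 → ∀ y, u τ y = (T₀ - τ) ^ (g - 1) • W ((T₀ - τ) ^ (-g) • y))
    {κ R₁ : ℝ} (hκ : κ < g) (hR₁ : ∀ y : EuclideanSpace ℝ (Fin 3), R₁ ≤ ‖y‖ → -(κ * ‖y‖ ^ 2) ≤ ⟪y, W y⟫) :
    uncurry u =ᵐ[volume.restrict (Iio (0 : ℝ) ×ˢ (univ : Set (EuclideanSpace ℝ (Fin 3))))] 0 :=
  have hprof := isSelfSimilarEulerProfile hcl hT₀ hW
  ae_eq_zero_of_curl_eq_zero hρ hρh hgauge hcl hT₀ hW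
    (fun x => Loc.curl_eq_zero_of_radialInflow hprof hκ hR₁ hg hg2 x)

/-- **Corollary — UNIFORMLY CONTINUOUS profile** (⊇ bounded gradient): the one-slice growth + ns-typeII-p1 g8's spike estimate give `W = o(|y|)`, hence no fast inflow
at rate `g/2 < g`. [folklore] -/
theorem ae_eq_zero_of_uniformContinuous (hρ : 0 < ρ) (hρh : ρ ≤ 1 / 2)
    (hgauge : ∀ a : ℝ, 0 < a →
      ENNReal.ofReal (a ^ (2 * ρ)) * cknA a (0 : ℝ × EuclideanSpace ℝ (Fin 3)) u +
          ENNReal.ofReal (a ^ ρ) * cknE a (0 : ℝ × EuclideanSpace ℝ (Fin 3)) H +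
        ENNReal.ofReal (a ^ (2 * ρ)) * cknD a (0 : ℝ × EuclideanSpace ℝ (Fin 3)) p ≤ (c : ℝ≥0∞))
    (hcl : IsClassicalEulerSolutionOn (Iio 0) 0 u p) (hT₀ : 0 ≤ T₀) (hg : 0 < g) (hg2 : g < 1 / 2)
    (hW : ∀ τ : ℝ, τ < 0 → ∀ y, u τ y = (T₀ - τ) ^ (g - 1) • W ((T₀ - τ) ^ (-g) • y))
    (hUC : UniformContinuous W) :
    uncurry u =ᵐ[volume.restrict (Iio (0 : ℝ) ×ˢ (univ : Set (EuclideanSpace ℝ (Fin 3))))] 0 := by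
  have hA : ∀ a : ℝ, 0 < a → ENNReal.ofReal (a ^ (2 * ρ)) *
      cknA a (0 : ℝ × EuclideanSpace ℝ (Fin 3)) u ≤ (c : ℝ≥0∞) :=
    fun a ha => le_trans (le_trans le_self_add le_self_add) (hgauge a ha)
  obtain ⟨C, hC, hgrowth⟩ := profile_growth hρ hρh hT₀ hA hW hUC.continuous
  have hsub := Loc.sublinear_of_uniformContinuous_of_growth hUC hC (θ := 1 - 2 * ρ) (by linarith) hgrowth
  obtain ⟨R₁, hR₁⟩ := hsub (g / 2) (by positivity)
  exact ae_eq_zero_of_radialInflow hρ hρh hgauge hcl hT₀ hg hg2 hW (κ := g / 2) (by linarith)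
    (Loc.radialInflow_of_subdrift hR₁)

/-- **Corollary — COMPACTLY SUPPORTED VORTICITY**: the Eulerian `p → 0` identity (`IsSelfSimilarEulerProfile.curl_eq_zero_of_hasCompactSupport`, any `g > 0`)
makes the profile irrotational. [cite: ChaeShvydkoy2013, §4 Thm. 4.1 (proof)] -/
theorem ae_eq_zero_of_compactCurl (hρ : 0 < ρ) (hρh : ρ ≤ 1 / 2)
    (hgauge : ∀ a : ℝ, 0 < a →
      ENNReal.ofReal (a ^ (2 * ρ)) * cknA a (0 : ℝ × EuclideanSpace ℝ (Fin 3)) u +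
          ENNReal.ofReal (a ^ ρ) * cknE a (0 : ℝ × EuclideanSpace ℝ (Fin 3)) H +
        ENNReal.ofReal (a ^ (2 * ρ)) * cknD a (0 : ℝ × EuclideanSpace ℝ (Fin 3)) p ≤ (c : ℝ≥0∞))
    (hcl : IsClassicalEulerSolutionOn (Iio 0) 0 u p) (hT₀ : 0 ≤ T₀) (hg : 0 < g)
    (hW : ∀ τ : ℝ, τ < 0 → ∀ y, u τ y = (T₀ - τ) ^ (g - 1) • W ((T₀ - τ) ^ (-g) • y))
    (hΩc : HasCompactSupport (curl W)) :
    uncurry u =ᵐ[volume.restrict (Iio (0 : ℝ) ×ˢ (univ : Set (EuclideanSpace ℝ (Fin 3))))] 0 :=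
  have hprof := isSelfSimilarEulerProfile hcl hT₀ hW
  have hcurl0 : curl W = 0 := hprof.curl_eq_zero_of_hasCompactSupport hg hΩc
  ae_eq_zero_of_curl_eq_zero hρ hρh hgauge hcl hT₀ hW fun x => congrFun hcurl0 x

end PowerClock

end Summit.NavierStokesRegularity.NavierStokesRegularity.Theorems.PowerGaugeEulerLiouville

end
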